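import Mathlib
import Literature.Analysis.FluidPDE.SelfSimilar
import HarnessLib

/-!
# Vanishing window increments pass to pointwise limits

Crux `RecurrentLiouville` (stmt-NavierStokesRegularity-1589), line `Sketch`, skeleton v6
(Giga–Kohn harvest), stub S1a `stub_gkInvariantOfTendsto`.

If fields `w k`, continuous on the open backward slab `{t < 0} × ℝ³`, converge pointwise on the
slab to a field `W` continuous on the slab, and their scaling-orbit increments
`∫_{(−2,−1)×B_R} ‖c w_k(c²t, cx) − w_k(t,x)‖²` tend to `0` for every `R > 0` and every scale
factor `c` with `1 ≤ c`, `c² ≤ 2`, then `W` is EXACTLY scale invariant on the window: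
`c W(c²t, cx) = W(t,x)` for those `c`, all `t ∈ (−2,−1)` and all `x`.

Proof: Fatou's lemma on each open box `(−2,−1) × B_R` (the increment densities converge
pointwise, so the increment of `W` has integral `≤ liminf = 0`); hence the continuous increment
density of `W` vanishes a.e. on the open box, hence everywhere on it (Lebesgue measure charges
open sets).  Pure measure theory / topology; no PDE.
-/

noncomputable section

-- the sub-problem namespace repeats the summit name (D-0017 layout `Summit.<S>.<P>.Theorems`)
set_option linter.dupNamespace false

namespace Summit.NavierStokesRegularity.NavierStokesRegularity.Theorems

open MeasureTheory Set Function Filter Topology TopologicalSpace Metric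
open Literature.Analysis Literature.Analysis.FluidPDE
open scoped NNReal ENNReal

/-- **Fatou + continuity on an open set.**  If nonnegative densities `F k`, continuous on an open
set `U`, converge pointwise on `U` to a density `G` continuous on `U`, and `∫_U F k → 0`, then
`G = 0` on `U` (for a measure charging open sets). [folklore] -/
theorem gkInv_eqOn_zero_of_tendsto_setLIntegral {X : Type*} [TopologicalSpace X]
    [MeasurableSpace X] [OpensMeasurableSpace X] {μ : Measure X} [μ.IsOpenPosMeasure]
    {U : Set X} (hU : IsOpen U) {F : ℕ → X → ℝ≥0∞} {G : X → ℝ≥0∞}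
    (hF : ∀ k, ContinuousOn (F k) U) (hG : ContinuousOn G U)
    (hpt : ∀ z ∈ U, Tendsto (fun k => F k z) atTop (𝓝 (G z)))
    (hint : Tendsto (fun k => ∫⁻ z in U, F k z ∂μ) atTop (𝓝 0)) : ∀ z ∈ U, G z = 0 := by
  have hUm : MeasurableSet U := hU.measurableSet
  have hGint : ∫⁻ z in U, G z ∂μ = 0 := by
    refine le_antisymm ?_ zero_le
    calc ∫⁻ z in U, G z ∂μ = ∫⁻ z in U, liminf (fun k => F k z) atTop ∂μ :=
          setLIntegral_congr_fun hUm fun z hz => ((hpt z hz).liminf_eq).symm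
      _ ≤ liminf (fun k => ∫⁻ z in U, F k z ∂μ) atTop :=
          lintegral_liminf_le' fun k => (hF k).aemeasurable hUm
      _ = 0 := hint.liminf_eq
  have hae : G =ᵐ[μ.restrict U] 0 := (lintegral_eq_zero_iff' (hG.aemeasurable hUm)).1 hGint
  have hEq : EqOn G (fun _ => 0) U := Measure.eqOn_open_of_ae_eq hae hU hG continuousOn_const
  exact fun z hz => hEq hz

/-- The parabolically dilated field `z ↦ v (c² z.1) (c z.2)` of a field continuous on the open
backward slab is continuous on the slab (`0 < c`: the dilation maps the slab into itself).
[folklore] -/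
private theorem gkInv_continuousOn_dilate
    (v : ℝ → EuclideanSpace ℝ (Fin 3) → EuclideanSpace ℝ (Fin 3))
    (hv : ContinuousOn (uncurry v) (Iio (0 : ℝ) ×ˢ univ)) {c : ℝ} (hc : 0 < c) :
    ContinuousOn (fun z : ℝ × EuclideanSpace ℝ (Fin 3) => v (c ^ 2 * z.1) (c • z.2))
      (Iio (0 : ℝ) ×ˢ univ) := by
  have hmap : MapsTo (fun z : ℝ × EuclideanSpace ℝ (Fin 3) => (c ^ 2 * z.1, c • z.2))
      (Iio (0 : ℝ) ×ˢ univ) (Iio (0 : ℝ) ×ˢ univ) := by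
    intro z hz
    have hz1 : z.1 < 0 := hz.1
    exact mk_mem_prod (mul_neg_of_pos_of_neg (pow_pos hc 2) hz1) (mem_univ _)
  have hcont : Continuous (fun z : ℝ × EuclideanSpace ℝ (Fin 3) => (c ^ 2 * z.1, c • z.2)) := by
    fun_prop
  exact hv.comp hcont.continuousOn hmap

/-- The increment density `z ↦ ‖c v(c² z.1, c z.2) − v(z.1, z.2)‖ₑ²` of a field continuous on
the open backward slab is continuous on the slab (`0 < c`). [folklore] -/
private theorem gkInv_continuousOn_density
    (v : ℝ → EuclideanSpace ℝ (Fin 3) → EuclideanSpace ℝ (Fin 3))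
    (hv : ContinuousOn (uncurry v) (Iio (0 : ℝ) ×ˢ univ)) {c : ℝ} (hc : 0 < c) :
    ContinuousOn
      (fun z : ℝ × EuclideanSpace ℝ (Fin 3) => ‖nsRescale c v z.1 z.2 - v z.1 z.2‖ₑ ^ 2)
      (Iio (0 : ℝ) ×ˢ univ) := by
  have h1 : ContinuousOn
      (fun z : ℝ × EuclideanSpace ℝ (Fin 3) => c • v (c ^ 2 * z.1) (c • z.2))
      (Iio (0 : ℝ) ×ˢ univ) :=
    (gkInv_continuousOn_dilate v hv hc).const_smul c
  have h2 : ContinuousOn (fun z : ℝ × EuclideanSpace ℝ (Fin 3) => v z.1 z.2)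
      (Iio (0 : ℝ) ×ˢ univ) := hv
  have h3 := (ENNReal.continuous_pow 2).comp_continuousOn (h1.sub h2).enorm
  simpa only [nsRescale_apply, Function.comp_def, Pi.sub_apply] using h3

/-- Pointwise convergence of the fields on the open backward slab gives pointwise convergence of
the increment densities there (`0 < c`). [folklore] -/
private theorem gkInv_tendsto_density
    (w : ℕ → ℝ → EuclideanSpace ℝ (Fin 3) → EuclideanSpace ℝ (Fin 3))
    (W : ℝ → EuclideanSpace ℝ (Fin 3) → EuclideanSpace ℝ (Fin 3))
    (hpt : ∀ t : ℝ, t < 0 → ∀ x, Tendsto (fun k => w k t x) atTop (𝓝 (W t x)))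
    {c : ℝ} (hc : 0 < c) {z : ℝ × EuclideanSpace ℝ (Fin 3)} (hz : z.1 < 0) :
    Tendsto (fun k => ‖nsRescale c (w k) z.1 z.2 - w k z.1 z.2‖ₑ ^ 2) atTop
      (𝓝 (‖nsRescale c W z.1 z.2 - W z.1 z.2‖ₑ ^ 2)) := by
  have hcz : c ^ 2 * z.1 < 0 := mul_neg_of_pos_of_neg (pow_pos hc 2) hz
  have h1 : Tendsto (fun k => c • w k (c ^ 2 * z.1) (c • z.2)) atTop
      (𝓝 (c • W (c ^ 2 * z.1) (c • z.2))) :=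
    (hpt _ hcz _).const_smul c
  have h2 := ENNReal.Tendsto.pow (n := 2) (h1.sub (hpt _ hz z.2)).enorm
  simpa only [nsRescale_apply] using h2

/-- **Vanishing window increments pass to pointwise limits.**  If fields `w k`, continuous on the
open slab, converge pointwise on `{t < 0}` to a field `W` continuous on the open slab, and their
orbit increments on `(−2,−1) × B_R` tend to `0` for every `R > 0` and every `c` with `1 ≤ c`,
`c² ≤ 2`, then `W` is scale invariant on the window: `c W(c²t, cx) = W(t,x)` for those `c`, all
`t ∈ (−2,−1)` and all `x` (Fatou's lemma on each box, then continuity). [folklore] -/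
theorem stub_gkInvariantOfTendsto :
    ∀ (w : ℕ → ℝ → EuclideanSpace ℝ (Fin 3) → EuclideanSpace ℝ (Fin 3))
      (W : ℝ → EuclideanSpace ℝ (Fin 3) → EuclideanSpace ℝ (Fin 3)),
      (∀ k, ContinuousOn (uncurry (w k)) (Iio (0 : ℝ) ×ˢ univ)) →
      ContinuousOn (uncurry W) (Iio (0 : ℝ) ×ˢ univ) →
      (∀ t : ℝ, t < 0 → ∀ x, Tendsto (fun k => w k t x) atTop (𝓝 (W t x))) →
      (∀ R : ℝ, 0 < R → ∀ c : ℝ, 1 ≤ c → c ^ 2 ≤ 2 →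
        Tendsto (fun k => ∫⁻ z in Ioo (-2 : ℝ) (-1) ×ˢ Metric.ball (0 : EuclideanSpace ℝ (Fin 3)) R,
          ‖nsRescale c (w k) z.1 z.2 - w k z.1 z.2‖ₑ ^ 2) atTop (𝓝 0)) →
      ∀ c : ℝ, 1 ≤ c → c ^ 2 ≤ 2 → ∀ t ∈ Ioo (-2 : ℝ) (-1), ∀ x : EuclideanSpace ℝ (Fin 3),
        nsRescale c W t x = W t x := by
  intro w W hw hW hpt hincr c hc1 hc2 t ht x
  have hc : 0 < c := one_pos.trans_le hc1
  have hR : 0 < ‖x‖ + 1 := by positivity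
  have hUopen :
      IsOpen (Ioo (-2 : ℝ) (-1) ×ˢ Metric.ball (0 : EuclideanSpace ℝ (Fin 3)) (‖x‖ + 1)) :=
    isOpen_Ioo.prod Metric.isOpen_ball
  have hUslab :
      Ioo (-2 : ℝ) (-1) ×ˢ Metric.ball (0 : EuclideanSpace ℝ (Fin 3)) (‖x‖ + 1) ⊆
        Iio (0 : ℝ) ×ˢ univ :=
    prod_mono (fun s hs => lt_trans hs.2 (by norm_num)) (subset_univ _)
  have hEq := gkInv_eqOn_zero_of_tendsto_setLIntegral (μ := volume) hUopen
    (F := fun k z => ‖nsRescale c (w k) z.1 z.2 - w k z.1 z.2‖ₑ ^ 2)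
    (G := fun z => ‖nsRescale c W z.1 z.2 - W z.1 z.2‖ₑ ^ 2)
    (fun k => (gkInv_continuousOn_density (w k) (hw k) hc).mono hUslab)
    ((gkInv_continuousOn_density W hW hc).mono hUslab)
    (fun z hz => gkInv_tendsto_density w W hpt hc (hUslab hz).1)
    (hincr _ hR c hc1 hc2)
  have htx :
      (t, x) ∈ Ioo (-2 : ℝ) (-1) ×ˢ Metric.ball (0 : EuclideanSpace ℝ (Fin 3)) (‖x‖ + 1) :=
    mk_mem_prod ht (mem_ball_zero_iff.2 (lt_add_one _))
  have h0 : ‖nsRescale c W t x - W t x‖ₑ ^ 2 = 0 := hEq (t, x) htx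
  have h1 : ‖nsRescale c W t x - W t x‖ₑ = 0 := (pow_eq_zero_iff two_ne_zero).1 h0
  exact sub_eq_zero.1 (enorm_eq_zero.1 h1)

end Summit.NavierStokesRegularity.NavierStokesRegularity.Theorems
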